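import Summits.QuantumFields.YangMills.Theorems.SmallFieldWideningWideningOfTiltAndMassSmallFieldCauchy

/-!
# Route SmallFieldWidening — LINE g6-C «Cauchy door»: the plumbing item `CauchyAssembly`

`CauchyAssembly : WindowCondCauchy → LargeFieldMassRefinementTail → YM3TorusSU2` (support item
stmt-QuantumFields-27835 of route `SmallFieldWidening`, rung R3 of LADDER-YM) is exactly the widening
`WideningSmallFieldCauchy.ym3TorusSU2_of_windowCondCauchy` landed by ym-line-sfw-p1 g6; that module imports the
route file, so the route's deciding theorem `closes (hS) (hM) (hA) := hA hS hM` carries it as a binder and this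
file discharges it.  No summit (YM mass gap / continuum limit) is proved here: the leaf is rung R3.
-/

namespace Summit.QuantumFields.YangMills.Theorems

/-- The support item `CauchyAssembly` of route `SmallFieldWidening` holds (LINE g6-C plumbing). -/
theorem smallFieldWidening_cauchyAssembly_proof :
    Summit.QuantumFields.YangMills.Theses.SmallFieldWidening.CauchyAssembly :=
  fun hS hM => WideningSmallFieldCauchy.ym3TorusSU2_of_windowCondCauchy hS hM

/-- The Cauchy-door decision of rung R3, by name: the two open cruxes of LINE g6-C suffice. -/
theorem ym3TorusSU2_of_lineC
    (hS : Summit.QuantumFields.YangMills.Theses.SmallFieldWidening.WindowCondCauchy)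
    (hM : Summit.QuantumFields.YangMills.Theses.SmallFieldWidening.LargeFieldMassRefinementTail) :
    Literature.MathematicalPhysics.QuantumFieldTheory.Balaban1983to89.T3YM3TorusStatement.YM3TorusSU2 :=
  Summit.QuantumFields.YangMills.Theses.SmallFieldWidening.closes hS hM smallFieldWidening_cauchyAssembly_proof

end Summit.QuantumFields.YangMills.Theorems
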